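/-
Copyright (c) 2026 the pub-hodgecm-mathlib formalisation cell (harness21).  Prover seat hodgecm-mathlib-K2Liu-p14 (g0): Track B «K2-LIT»,
hLiu418 = stmt-HodgeConjecture-24832; LEAD F0P6-plan (g13) RULING M-157b + «=» 2026-09-04T08:59:05Z «(β4-ii) FIRST», file (β4-ii) part 1.
-/
import Literature.NumberTheory.Automorphic.HeckeIntegralPureTensorEuler       -- ★ `tendsto_union_map_subtype_atTop`, `disjoint_map_subtype`; brings ★ `IdeleUnitBox{Splitting,SplittingConstants,Exhaustion}`
import Literature.NumberTheory.Automorphic.TateLocalFunctionalEquation         -- ★ `tateZeta_indicator_primePowBall_of_isUnramified`, `QuasiChar.hasExponent_one`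
import Literature.NumberTheory.Automorphic.AddCharConductorExponent             -- ★ `mem_primePowBall_adicCompletion_iff`, `exists_normAbs_eq_inv_zpow_of_int`
import Literature.NumberTheory.Automorphic.AdicCompletionResidueCard            -- ★ `residueFieldCard_adicCompletion_eq`
import HarnessLib

/-!
# Crux `HLiu418`, road `K2_Liu`, Road Φ organ G5 (β) «Godement sections exhaust», file (β4-ii) part 1:
# IDELIC EULER LIMITS — the abstract box-to-idele limit, and the two local factors `μ_v(𝒪_vˣ)` and `μ_v(𝒪_vˣ)·ζ_v(w)`

Cell `hodgecm-mathlib`, crux item hLiu418 = `stmt-HodgeConjecture-24832`; squad K2 ∕ K2Liu; prover K2Liu-p14 (g0).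
THEOREMS ONLY (no `def`, no instance, no notation, no named-fact hypothesis, no `sorry`); lane `--supports stmt-HodgeConjecture-24832`
(count-neutral helper).  GENERIC number field `K`; the tree's idele toolkit ★ `IdeleUnitBox{Shells,Splitting,SplittingConstants,Exhaustion}`
(boxes `B(Sᶜ) = ideleUnitBox {w | w ∉ S}`, archimedean∕`S`-adic coordinates `archUnitsOfIdele`, `ideleGroup.finComp`) and ★ Tate's local zeta integrals.

CONTENTS (the two halves of (β4-ii) `K2LiuIdelicUnramifiedZetaProduct` that do not see the specific integrand):
* §1 **`integral_eq_mul_of_forall_setIntegral_box_eq`** — if `F ∈ L¹(ν)` on `𝕀_K` and on every box `B((S ∪ T)ᶜ)`, `T` a finite set of places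
  outside `S`, `∫_{B((S∪T)ᶜ)} F dν = A · ∏_{t∈T} L_t` with `HasProd L Λ`, then `∫_{𝕀_K} F dν = A · Λ` (★ `tendsto_setIntegral_ideleUnitBox_compl` ∘
  ★ `tendsto_union_map_subtype_atTop`, uniqueness of limits) — the abstract form of Jacquet–Langlands' «`Ψ = ∏_v Ψ_v`» limit.
* §2 the LOCAL FACTORS at a finite place `v` for a Haar measure `μ_v` on `K_vˣ` and `w ∈ ℂ`:
  `∫ 𝟙_{𝒪_vˣ}(y) |y|_v^w dμ_v = μ_v(𝒪_vˣ)` (`integral_indicator_units_mul_cpow`) and, for `0 < re w`,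
  **`∫ 𝟙_{𝒪_v ∖ 0}(y) |y|_v^w dμ_v = μ_v(𝒪_vˣ) · (1 − q_v^{−w})⁻¹`** (`integral_indicator_integers_mul_cpow`; ★ Tate `tateZeta_indicator_primePowBall_of_isUnramified`
  at the trivial quasi-character, `k = 0`) — the unramified Euler factor `ζ_v(w)` of ★ `partialStandardL S (fun _ ↦ {1}) w` (`q_v = v.residueCard`,
  ★ `residueFieldCard_adicCompletion_eq`); with its norm `∫ |…| = μ_v(𝒪_vˣ)·ζ_v(re w)` for ★ `integrable_of_norm_eq_mul_prod_on_ideleUnitBox`.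
* §3 `cpow` of finite products of non-negative reals.
HONEST LABEL.  `HC_CM` is proved only modulo the 7 printed citations (2 remaining named inputs: hLiu418 = `stmt-HodgeConjecture-24832`,
h413 = `stmt-HodgeConjecture-24833`) until rung 0 closes.

## References
* [CasselsFrohlichANT1967] J. W. S. Cassels, A. Fröhlich (eds.), *Algebraic Number Theory* (1967), Ch. XV (Tate) §4.3–§4.4 (integration over the `S`-ideles,
  `d^×a = ∏ d^×a_v`), Thm. 3.3.1.
* [Tate1950] J. Tate, *Fourier analysis in number fields and Hecke's zeta-functions* (1950), §2.5 (the unramified local zeta integral).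
* [JacquetLanglands1970] H. Jacquet, R. P. Langlands, *Automorphic forms on GL(2)*, LNM 114 (1970), §11 p. 171 (`Ψ = ∏_v Ψ_v`).
-/

set_option autoImplicit false
set_option linter.dupNamespace false -- the mandated namespace repeats `HodgeConjecture.HodgeConjecture`

noncomputable section

open MeasureTheory Measure NumberField IsDedekindDomain Set Filter Topology
open scoped NNReal ENNReal Classical
open Literature.NumberTheory.GaloisRepresentations (ideleGroup)
open Literature.NumberTheory.GaloisRepresentations.IsNonarchimedeanLocalField
open Literature.NumberTheory.Automorphic

namespace Summit.HodgeConjecture.HodgeConjecture.Cruxes.HLiu418.K2LiuIdelicEulerLimit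

variable {K : Type} [Field K] [NumberField K]

/-! ## §1 The abstract box-to-idele limit -/

section Limit

variable [MeasurableSpace (ideleGroup K)] [BorelSpace (ideleGroup K)]

/-- **`∫_{𝕀_K} F = A · ∏'_t L_t`** when the integrals of the integrable `F` over the boxes `B((S ∪ T)ᶜ)` are `A · ∏_{t∈T} L_t` and the local factors
`L_t`, `t ∉ S`, have the product `Λ` (★ `tendsto_setIntegral_ideleUnitBox_compl`, ★ `tendsto_union_map_subtype_atTop`, uniqueness of limits).
[cite: JacquetLanglands1970, §11 p. 171] [cite: CasselsFrohlichANT1967, Ch. XV §4.4] -/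
theorem integral_eq_mul_of_forall_setIntegral_box_eq (ν : Measure (ideleGroup K)) {F : ideleGroup K → ℂ} (hF : Integrable F ν)
    (S : Finset (HeightOneSpectrum (𝓞 K))) (A : ℂ) {L : {v : HeightOneSpectrum (𝓞 K) // v ∉ S} → ℂ} {Λ : ℂ} (hL : HasProd L Λ)
    (hbox : ∀ T : Finset {v : HeightOneSpectrum (𝓞 K) // v ∉ S},
      ∫ a in ideleUnitBox (K := K) {w | w ∉ S ∪ T.map (Function.Embedding.subtype fun v => v ∉ S)}, F a ∂ν = A * ∏ t ∈ T, L t) :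
    ∫ a, F a ∂ν = A * Λ := by
  have h1 : Tendsto (fun T : Finset {v : HeightOneSpectrum (𝓞 K) // v ∉ S} =>
      ∫ a in ideleUnitBox (K := K) {w | w ∉ S ∪ T.map (Function.Embedding.subtype fun v => v ∉ S)}, F a ∂ν)
      atTop (𝓝 (∫ a, F a ∂ν)) :=
    (tendsto_setIntegral_ideleUnitBox_compl ν hF).comp (tendsto_union_map_subtype_atTop S)
  have h2 : Tendsto (fun T : Finset {v : HeightOneSpectrum (𝓞 K) // v ∉ S} => A * ∏ t ∈ T, L t) atTop (𝓝 (A * Λ)) :=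
    hL.const_mul A
  exact tendsto_nhds_unique (h1.congr fun T => hbox T) h2

end Limit

/-! ## §2 The local factors at a finite place -/

section Local

variable (v : HeightOneSpectrum (𝓞 K)) [MeasurableSpace (v.adicCompletion K)] [BorelSpace (v.adicCompletion K)]

omit [MeasurableSpace (v.adicCompletion K)] [BorelSpace (v.adicCompletion K)] in
/-- on the unit sphere `|y|_v = 1`. [folklore] -/
theorem normAbs_eq_one_of_valued_eq_one {y : (v.adicCompletion K)ˣ} (hy : Valued.v (y : v.adicCompletion K) = 1) :
    normAbs (v.adicCompletion K) (y : v.adicCompletion K) = 1 :=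
  DeltaCharBorel.normAbs_eq_one_of_valuation_eq_one ((valued_eq_one_iff_valuation_eq_one v _).1 hy)

/-- **`∫ 𝟙_{𝒪_vˣ}(y) |y|_v^w dμ_v = μ_v(𝒪_vˣ)`** (any measure `μ_v`, any `w`: the integrand is the indicator of the unit group). [cite: Tate1950, §2.5] -/
theorem integral_indicator_units_mul_cpow (μv : Measure (v.adicCompletion K)ˣ) (w : ℂ) :
    ∫ y : (v.adicCompletion K)ˣ, {y : (v.adicCompletion K)ˣ | Valued.v (y : v.adicCompletion K) = 1}.indicator (fun _ => (1 : ℂ)) y *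
        (((normAbs (v.adicCompletion K) (y : v.adicCompletion K) : ℝ≥0) : ℝ) : ℂ) ^ w ∂μv =
      (μv.real {y : (v.adicCompletion K)ˣ | Valued.v (y : v.adicCompletion K) = 1} : ℂ) := by
  have h : ∀ y : (v.adicCompletion K)ˣ,
      {y : (v.adicCompletion K)ˣ | Valued.v (y : v.adicCompletion K) = 1}.indicator (fun _ => (1 : ℂ)) y *
        (((normAbs (v.adicCompletion K) (y : v.adicCompletion K) : ℝ≥0) : ℝ) : ℂ) ^ w =
      {y : (v.adicCompletion K)ˣ | Valued.v (y : v.adicCompletion K) = 1}.indicator (fun _ => (1 : ℂ)) y := by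
    intro y
    by_cases hy : y ∈ {y : (v.adicCompletion K)ˣ | Valued.v (y : v.adicCompletion K) = 1}
    · rw [Set.indicator_of_mem hy, normAbs_eq_one_of_valued_eq_one v hy, NNReal.coe_one, Complex.ofReal_one, Complex.one_cpow, one_mul]
    · rw [Set.indicator_of_notMem hy, zero_mul]
  haveI : BorelSpace (v.adicCompletion K)ˣ := Units.borelSpace
  simp_rw [h]
  rw [integral_indicator_const _ (isOpen_units_valued_eq_one v).measurableSet, Complex.real_smul, mul_one]

/-- the norm of that integrand integrates to the same (real) number. [cite: Tate1950, §2.5] -/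
theorem integral_norm_indicator_units_mul_cpow (μv : Measure (v.adicCompletion K)ˣ) (w : ℂ) :
    ∫ y : (v.adicCompletion K)ˣ, ‖{y : (v.adicCompletion K)ˣ | Valued.v (y : v.adicCompletion K) = 1}.indicator (fun _ => (1 : ℂ)) y *
        (((normAbs (v.adicCompletion K) (y : v.adicCompletion K) : ℝ≥0) : ℝ) : ℂ) ^ w‖ ∂μv =
      μv.real {y : (v.adicCompletion K)ˣ | Valued.v (y : v.adicCompletion K) = 1} := by
  have h : ∀ y : (v.adicCompletion K)ˣ,
      ‖{y : (v.adicCompletion K)ˣ | Valued.v (y : v.adicCompletion K) = 1}.indicator (fun _ => (1 : ℂ)) y *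
        (((normAbs (v.adicCompletion K) (y : v.adicCompletion K) : ℝ≥0) : ℝ) : ℂ) ^ w‖ =
      {y : (v.adicCompletion K)ˣ | Valued.v (y : v.adicCompletion K) = 1}.indicator (fun _ => (1 : ℝ)) y := by
    intro y
    by_cases hy : y ∈ {y : (v.adicCompletion K)ˣ | Valued.v (y : v.adicCompletion K) = 1}
    · rw [Set.indicator_of_mem hy, Set.indicator_of_mem hy, normAbs_eq_one_of_valued_eq_one v hy, NNReal.coe_one, Complex.ofReal_one,
        Complex.one_cpow, one_mul, norm_one]
    · rw [Set.indicator_of_notMem hy, Set.indicator_of_notMem hy, zero_mul, norm_zero]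
  haveI : BorelSpace (v.adicCompletion K)ˣ := Units.borelSpace
  simp_rw [h]
  rw [integral_indicator_const _ (isOpen_units_valued_eq_one v).measurableSet, smul_eq_mul, mul_one]

omit [MeasurableSpace (v.adicCompletion K)] [BorelSpace (v.adicCompletion K)] in
/-- the integers of `K_vˣ`: `Valued.v y ≤ 1 ↔ y ∈ 𝔭^0 = 𝒪_v`. [folklore] -/
theorem valued_le_one_iff_mem_primePowBall (y : v.adicCompletion K) :
    Valued.v y ≤ 1 ↔ y ∈ primePowBall (v.adicCompletion K) 0 := by
  rw [mem_primePowBall_adicCompletion_iff, neg_zero, WithZero.exp_zero]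

omit [MeasurableSpace (v.adicCompletion K)] [BorelSpace (v.adicCompletion K)] in
/-- the unit sphere of `K_vˣ` in `Valued.v` and in `valuation` spelling. [folklore] -/
theorem setOf_valued_eq_one_eq_setOf_valuation_eq_one :
    {y : (v.adicCompletion K)ˣ | Valued.v (y : v.adicCompletion K) = 1} =
      {y : (v.adicCompletion K)ˣ | ValuativeRel.valuation (v.adicCompletion K) (y : v.adicCompletion K) = 1} := by
  ext y; exact valued_eq_one_iff_valuation_eq_one v _

/-- **THE UNRAMIFIED LOCAL FACTOR `∫ 𝟙_{𝒪_v}(y) |y|_v^w dμ_v = μ_v(𝒪_vˣ) · (1 − q_v^{−w})⁻¹`**, `0 < re w`, `μ_v` a Haar measure on `K_vˣ`, `q_v = v.residueCard`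
(★ Tate's computation at the trivial quasi-character, `k = 0`). [cite: Tate1950, §2.5] [cite: CasselsFrohlichANT1967, Ch. XV §4.4] -/
theorem integral_indicator_integers_mul_cpow (μv : Measure (v.adicCompletion K)ˣ) [μv.IsHaarMeasure] {w : ℂ} (hw : 0 < w.re) :
    ∫ y : (v.adicCompletion K)ˣ, {y : (v.adicCompletion K)ˣ | Valued.v (y : v.adicCompletion K) ≤ 1}.indicator (fun _ => (1 : ℂ)) y *
        (((normAbs (v.adicCompletion K) (y : v.adicCompletion K) : ℝ≥0) : ℝ) : ℂ) ^ w ∂μv =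
      (μv.real {y : (v.adicCompletion K)ˣ | Valued.v (y : v.adicCompletion K) = 1} : ℂ) * (1 - (v.residueCard : ℂ) ^ (-w))⁻¹ := by
  -- a uniformizer with `|ϖ| = q⁻¹`
  obtain ⟨ϖ, hϖ0, hϖ⟩ := exists_normAbs_eq_inv_zpow_of_int (F := v.adicCompletion K) 1
  rw [zpow_one] at hϖ
  have hT := tateZeta_indicator_primePowBall_of_isUnramified μv (χ := (1 : QuasiChar (v.adicCompletion K))) (fun _ _ => rfl)
    QuasiChar.hasExponent_one hϖ0 hϖ 0 (s := w) (by rw [neg_zero]; exact hw)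
  have hone : ∀ x : (v.adicCompletion K)ˣ, (((1 : QuasiChar (v.adicCompletion K)) x : ℂˣ) : ℂ) = 1 := fun _ => rfl
  rw [setOf_valued_eq_one_eq_setOf_valuation_eq_one, ← residueFieldCard_adicCompletion_eq (K := K) v]
  rw [hone, one_mul, zpow_zero, mul_one, div_eq_mul_inv] at hT
  rw [← hT, tateZeta]
  refine integral_congr_ae (Filter.Eventually.of_forall fun y => ?_)
  show {y : (v.adicCompletion K)ˣ | Valued.v (y : v.adicCompletion K) ≤ 1}.indicator (fun _ => (1 : ℂ)) y *
        (((normAbs (v.adicCompletion K) (y : v.adicCompletion K) : ℝ≥0) : ℝ) : ℂ) ^ w =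
      (primePowBall (v.adicCompletion K) 0).indicator (fun _ => (1 : ℂ)) (y : v.adicCompletion K) *
        (((1 : QuasiChar (v.adicCompletion K)) y : ℂˣ) : ℂ) * (((normAbs (v.adicCompletion K) (y : v.adicCompletion K) : ℝ≥0) : ℝ) : ℂ) ^ w
  rw [hone, mul_one]
  congr 1
  by_cases hy : Valued.v (y : v.adicCompletion K) ≤ 1
  · rw [Set.indicator_of_mem (show y ∈ {y : (v.adicCompletion K)ˣ | Valued.v (y : v.adicCompletion K) ≤ 1} from hy),
      Set.indicator_of_mem ((valued_le_one_iff_mem_primePowBall v _).1 hy)]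
  · rw [Set.indicator_of_notMem (show y ∉ {y : (v.adicCompletion K)ˣ | Valued.v (y : v.adicCompletion K) ≤ 1} from hy),
      Set.indicator_of_notMem (fun h => hy ((valued_le_one_iff_mem_primePowBall v _).2 h))]

/-- **norm version**: `∫ |𝟙_{𝒪_v}(y) |y|_v^w| dμ_v = μ_v(𝒪_vˣ) · (1 − q_v^{−re w})⁻¹` for `0 < re w` (the integrand has norm `𝟙_{𝒪_v}|y|_v^{re w}`; the
identity is the previous one at the real parameter `re w`, read through `Complex.ofReal`). [cite: Tate1950, §2.5] -/
theorem integral_norm_indicator_integers_mul_cpow (μv : Measure (v.adicCompletion K)ˣ) [μv.IsHaarMeasure] {w : ℂ} (hw : 0 < w.re) :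
    ∫ y : (v.adicCompletion K)ˣ, ‖{y : (v.adicCompletion K)ˣ | Valued.v (y : v.adicCompletion K) ≤ 1}.indicator (fun _ => (1 : ℂ)) y *
        (((normAbs (v.adicCompletion K) (y : v.adicCompletion K) : ℝ≥0) : ℝ) : ℂ) ^ w‖ ∂μv =
      μv.real {y : (v.adicCompletion K)ˣ | Valued.v (y : v.adicCompletion K) = 1} * (1 - (v.residueCard : ℝ) ^ (-w.re))⁻¹ := by
  have h : ∀ y : (v.adicCompletion K)ˣ,
      ((‖{y : (v.adicCompletion K)ˣ | Valued.v (y : v.adicCompletion K) ≤ 1}.indicator (fun _ => (1 : ℂ)) y *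
        (((normAbs (v.adicCompletion K) (y : v.adicCompletion K) : ℝ≥0) : ℝ) : ℂ) ^ w‖ : ℝ) : ℂ) =
      {y : (v.adicCompletion K)ˣ | Valued.v (y : v.adicCompletion K) ≤ 1}.indicator (fun _ => (1 : ℂ)) y *
        (((normAbs (v.adicCompletion K) (y : v.adicCompletion K) : ℝ≥0) : ℝ) : ℂ) ^ ((w.re : ℝ) : ℂ) := by
    intro y
    have hpos : (0 : ℝ) < ((normAbs (v.adicCompletion K) (y : v.adicCompletion K) : ℝ≥0) : ℝ) :=
      NNReal.coe_pos.2 (pos_iff_ne_zero.2 ((map_ne_zero (normAbs (v.adicCompletion K))).2 y.ne_zero))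
    by_cases hy : y ∈ {y : (v.adicCompletion K)ˣ | Valued.v (y : v.adicCompletion K) ≤ 1}
    · rw [Set.indicator_of_mem hy, one_mul, one_mul, Complex.norm_cpow_eq_rpow_re_of_pos hpos, Complex.ofReal_cpow hpos.le]
    · rw [Set.indicator_of_notMem hy, zero_mul, zero_mul, norm_zero, Complex.ofReal_zero]
  have hre : (0 : ℝ) < (((w.re : ℝ) : ℂ)).re := by simpa using hw
  apply Complex.ofReal_injective
  rw [← integral_complex_ofReal]
  simp_rw [h]
  rw [integral_indicator_integers_mul_cpow v μv hre]
  have hq : ((v.residueCard : ℂ) ^ (-((w.re : ℝ) : ℂ))) = (((v.residueCard : ℝ) ^ (-w.re) : ℝ) : ℂ) := by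
    rw [Complex.ofReal_cpow (by positivity) (-w.re)]
    push_cast
    rfl
  rw [hq]
  push_cast
  rfl

end Local

/-! ## §3 Complex powers of finite products of non-negative reals -/

section Algebra

/-- `(∏_{i∈T} x_i)^w = ∏_{i∈T} x_i^w` for non-negative reals `x_i` (cast to `ℂ`). [folklore] -/
theorem prod_cpow_ofReal_nonneg {ι : Type*} (T : Finset ι) {x : ι → ℝ} (hx : ∀ i ∈ T, 0 ≤ x i) (w : ℂ) :
    (((∏ i ∈ T, x i : ℝ)) : ℂ) ^ w = ∏ i ∈ T, ((x i : ℝ) : ℂ) ^ w := by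
  classical
  induction T using Finset.induction_on with
  | empty => simp
  | insert a T ha ih =>
    rw [Finset.prod_insert ha, Finset.prod_insert ha, Complex.ofReal_mul,
      Complex.mul_cpow_ofReal_nonneg (hx a (Finset.mem_insert_self a T)) (Finset.prod_nonneg fun i hi => hx i (Finset.mem_insert_of_mem hi)),
      ih fun i hi => hx i (Finset.mem_insert_of_mem hi)]

end Algebra

end Summit.HodgeConjecture.HodgeConjecture.Cruxes.HLiu418.K2LiuIdelicEulerLimit

end
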